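import Summits.CriticalPhenomena.PercolationContinuityZ3.Theorems.PercNearOneGluingNoHeavyLowerTailSahiOneStepUniformMonoB
import Summits.CriticalPhenomena.PercolationContinuityZ3.Theorems.PercNearOneGluingNoHeavyLowerTailSahiOneStepUniformPrelim
import HarnessLib

/-!
# One-step scheme: the COSTLY-REGION REDUCTION of the partner, part 1/2 — the hull and the removal do not increase `n`

Support file (prover prim-ineq-prove-3 gen 53; `--supports stmt-CriticalPhenomena-4575`; memo
`run/shared/lean/prim/prim-ineq-prove-3/PROOF-G53-FREE-BLOCK.md` §2).  No definitions, no named facts, no sorries, no `native_decide`.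

Setting (`…SahiOneStepCone`): `μ = prodBernoulli p` (ANY density vector), blocks `K ⊆ S`, slot `H = Th_s(S) = {ω | s ≤ #(S ∩ ω)}`,
`L = Hᶜ`, `ℓ = μL`, free part `R = S ∖ K`, `φ_k = μ{#(R ∩ ω) + k < s}` (the `L`-probability of a `K`-pattern of level `k`), an increasing
`K`-determined event `A`, `n(A,B) = osN p H (ind A) (ind B)`.
* §1 `osN_ind_ind_union_right(_le_of_disjoint, _of_subset)`: the variation of `n(A,·)` when a set `D` is added to the partner: for `D`
  disjoint from `A` it is `μ(L∩D)μ(L∩A) − ℓ·μA·μD ≤ 0` (Harris); for `D ⊆ A` it is `ℓ·μD·μAᶜ − μ(L∩D)·μ(L∩Aᶜ)`.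
* §2 `real_inter_ball_le_mul_phi` / `mul_phi_le_real_inter_ball`: for a `K`-determined `D` on levels `≥ g` (resp. `≤ g`) of `K`,
  `μ(D∩L) ≤ μD·φ_g` (resp. `≥`) — independence of the `K`- and `R`-parts (`prodBernoulli_real_inter_of_determinedBy_disjoint`).
* §3 the COSTLY REGION `G = A ∩ {g ≤ #(K∩ω)}`, the hull `B♯ = {ω | every ω' ⊇ ω in G lies in B}` and the REMOVAL `B₂ = ↑(B♯ ∖ G)` (all written
  out; increasing, `K`-determined), and the two monotonicity facts: **`osN_sharp_le`** `n(A,B♯) ≤ n(A,B)` when the levels `< g` are free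
  (`φ_k·μ(L∩Aᶜ) ≥ ℓ·μAᶜ`, `k < g`) and **`osN_lift_le`** `n(A, ↑(Bs ∖ G)) ≤ n(A, Bs)` when level `g` is costly (`φ_g·μ(L∩Aᶜ) ≤ ℓ·μAᶜ`).
Part 2 (`…FreeBlockReduce`): after the reduction the partner does not depend on the pivot; the package `exists_free_reduct`.
-/

noncomputable section

namespace Summit.CriticalPhenomena.PercolationContinuityZ3.Theorems

namespace SahiOneStep

open MeasureTheory Finset
open Literature.Probability.Percolation (DeterminedBy determinedBy_iff)
open Literature.Probability.LatticeModels (prodBernoulli prodBernoulli_harris prodBernoulli_real_inter_of_determinedBy_disjoint)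
open Literature.Probability.Percolation.DecisionTree (ind)
open SahiE3Sections (determinedBy_section_insert determinedBy_section_sdiff)
open scoped Classical

variable {ι : Type*} [Fintype ι]

/-! ## §1 The variation of `n` in the partner -/

/-- Adding a set `D` disjoint from the partner `X`: the variation of `n(A,·)`. [this work] -/
theorem osN_ind_ind_union_right (p : ι → unitInterval) (H A X D : Set (Set ι)) (hXD : Disjoint X D) :
    osN p H (ind A) (ind (X ∪ D)) = osN p H (ind A) (ind X) +
      ((prodBernoulli p).real (H ∩ A) * (prodBernoulli p).real (H ∩ D)
        + (1 - (prodBernoulli p).real H) * (prodBernoulli p).real (H ∩ A ∩ D)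
        + (prodBernoulli p).real H * (prodBernoulli p).real A * (prodBernoulli p).real D
        - (prodBernoulli p).real (H ∩ A) * (prodBernoulli p).real D
        - (prodBernoulli p).real (H ∩ D) * (prodBernoulli p).real A) := by
  rw [osN_ind_ind, osN_ind_ind, Set.inter_union_distrib_left, Set.inter_union_distrib_left,
    measureReal_union (hXD.mono Set.inter_subset_right Set.inter_subset_right) MeasurableSet.of_discrete,
    measureReal_union (hXD.mono Set.inter_subset_right Set.inter_subset_right) MeasurableSet.of_discrete,
    measureReal_union hXD MeasurableSet.of_discrete]
  ring

/-- `μX − μ(H ∩ X) = μ(X ∩ Hᶜ)`. [folklore] -/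
theorem real_sub_real_inter_eq (p : ι → unitInterval) (H X : Set (Set ι)) :
    (prodBernoulli p).real X - (prodBernoulli p).real (H ∩ X) = (prodBernoulli p).real (X ∩ Hᶜ) := by
  have h := measureReal_inter_add_sdiff (μ := prodBernoulli p) (s := X) (t := H) MeasurableSet.of_discrete
  rw [Set.inter_comm] at h
  rw [← Set.sdiff_eq]
  linarith

/-- **Adding points outside `A` to the partner does not increase `n`** (`H`, `A` increasing): the variation equals
`μ(L∩D)·μ(L∩A) − ℓ·μA·μD ≤ 0` (`μ(L∩A) ≤ ℓ·μA` by Harris). [this work] -/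
theorem osN_ind_ind_union_right_le_of_disjoint (p : ι → unitInterval) {H A X D : Set (Set ι)} (hH : IsUpperSet H) (hA : IsUpperSet A)
    (hXD : Disjoint X D) (hDA : Disjoint D A) :
    osN p H (ind A) (ind (X ∪ D)) ≤ osN p H (ind A) (ind X) := by
  rw [osN_ind_ind_union_right p H A X D hXD, Set.inter_assoc, Set.disjoint_iff_inter_eq_empty.1 hDA.symm, Set.inter_empty,
    measureReal_empty]
  have hHar : (prodBernoulli p).real H * (prodBernoulli p).real A ≤ (prodBernoulli p).real (H ∩ A) :=
    prodBernoulli_harris p hH hA MeasurableSet.of_discrete MeasurableSet.of_discrete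
  have hAD : (prodBernoulli p).real (H ∩ D) ≤ (prodBernoulli p).real D := measureReal_mono Set.inter_subset_right
  have hAH : (prodBernoulli p).real (H ∩ A) ≤ (prodBernoulli p).real A := measureReal_mono Set.inter_subset_right
  have hD0 : 0 ≤ (prodBernoulli p).real D := measureReal_nonneg
  have hA0 : 0 ≤ (prodBernoulli p).real A := measureReal_nonneg
  have hH1 : (prodBernoulli p).real H ≤ 1 := measureReal_le_one
  have h1 : ((prodBernoulli p).real D - (prodBernoulli p).real (H ∩ D)) * ((prodBernoulli p).real A - (prodBernoulli p).real (H ∩ A)) ≤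
      ((prodBernoulli p).real D - (prodBernoulli p).real (H ∩ D)) * ((1 - (prodBernoulli p).real H) * (prodBernoulli p).real A) :=
    mul_le_mul_of_nonneg_left (by linarith) (sub_nonneg.2 hAD)
  have h2 : ((prodBernoulli p).real D - (prodBernoulli p).real (H ∩ D)) * ((1 - (prodBernoulli p).real H) * (prodBernoulli p).real A) ≤
      (prodBernoulli p).real D * ((1 - (prodBernoulli p).real H) * (prodBernoulli p).real A) :=
    mul_le_mul_of_nonneg_right (by linarith [(measureReal_nonneg : 0 ≤ (prodBernoulli p).real (H ∩ D))])
      (mul_nonneg (sub_nonneg.2 hH1) hA0)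
  have hid : (prodBernoulli p).real (H ∩ A) * (prodBernoulli p).real (H ∩ D) + (1 - (prodBernoulli p).real H) * 0
        + (prodBernoulli p).real H * (prodBernoulli p).real A * (prodBernoulli p).real D
        - (prodBernoulli p).real (H ∩ A) * (prodBernoulli p).real D
        - (prodBernoulli p).real (H ∩ D) * (prodBernoulli p).real A =
      ((prodBernoulli p).real D - (prodBernoulli p).real (H ∩ D)) * ((prodBernoulli p).real A - (prodBernoulli p).real (H ∩ A))
        - (prodBernoulli p).real D * ((1 - (prodBernoulli p).real H) * (prodBernoulli p).real A) := by ring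
  rw [hid]
  linarith

/-- Adding a subset `D ⊆ A` to the partner: the variation is `ℓ·μD·μAᶜ − μ(L∩D)·μ(L∩Aᶜ)` (`L = Hᶜ`, `ℓ = μL`), written with `H`. [this work] -/
theorem osN_ind_ind_union_right_of_subset (p : ι → unitInterval) (H A X D : Set (Set ι)) (hXD : Disjoint X D) (hDA : D ⊆ A) :
    osN p H (ind A) (ind (X ∪ D)) = osN p H (ind A) (ind X) +
      ((1 - (prodBernoulli p).real H) * (prodBernoulli p).real D * (1 - (prodBernoulli p).real A)
        - ((prodBernoulli p).real D - (prodBernoulli p).real (H ∩ D)) *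
          ((1 - (prodBernoulli p).real H) - ((prodBernoulli p).real A - (prodBernoulli p).real (H ∩ A)))) := by
  rw [osN_ind_ind_union_right p H A X D hXD, Set.inter_assoc, Set.inter_eq_self_of_subset_right hDA]
  ring

/-! ## §2 Levels of the block `K` inside the slot block `S`, and the free profile `φ` -/

omit [Fintype ι] in
/-- For `K ⊆ S`: `#(S ∩ ω) = #(K ∩ ω) + #((S ∖ K) ∩ ω)`. [folklore] -/
theorem card_filter_eq_add_sdiff {K S : Finset ι} (hKS : K ⊆ S) (ω : Set ι) :
    (S.filter (· ∈ ω)).card = (K.filter (· ∈ ω)).card + ((S \ K).filter (· ∈ ω)).card := by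
  rw [← Finset.card_union_of_disjoint (Finset.disjoint_filter_filter Finset.disjoint_sdiff), ← Finset.filter_union,
    Finset.union_sdiff_of_subset hKS]

/-- **Upper level bound.**  If `D` is `K`-determined and every `ω ∈ D` has `g ≤ #(K∩ω)`, then
`μ(D ∩ {#(S∩ω) < s}) ≤ μD · φ_g` with `φ_g = μ{#((S∖K)∩ω) + g < s}` (independence of the `K`- and `S∖K`-parts). [this work] -/
theorem real_inter_ball_le_mul_phi (p : ι → unitInterval) {K S : Finset ι} (hKS : K ⊆ S) {D : Set (Set ι)}
    (hDK : DeterminedBy D (↑K : Set ι)) (g s : ℕ) (hlev : ∀ ω ∈ D, g ≤ (K.filter (· ∈ ω)).card) :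
    (prodBernoulli p).real (D ∩ {ω : Set ι | (S.filter (· ∈ ω)).card < s}) ≤
      (prodBernoulli p).real D * (prodBernoulli p).real {ω : Set ι | ((S \ K).filter (· ∈ ω)).card + g < s} := by
  rw [← prodBernoulli_real_inter_of_determinedBy_disjoint p Finset.disjoint_sdiff hDK (determinedBy_shiftedBall (S \ K) g s)
    MeasurableSet.of_discrete MeasurableSet.of_discrete]
  refine measureReal_mono fun ω hω => ⟨hω.1, ?_⟩
  have h1 := hω.2
  simp only [Set.mem_setOf_eq] at h1 ⊢
  have h2 := card_filter_eq_add_sdiff hKS ω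
  have h3 := hlev ω hω.1
  omega
where
  /-- the shifted ball `{#(R∩ω) + g < s}` is `R`-determined -/
  determinedBy_shiftedBall (R : Finset ι) (g s : ℕ) :
      DeterminedBy {ω : Set ι | (R.filter (· ∈ ω)).card + g < s} (↑R : Set ι) := by
    rw [determinedBy_iff]
    intro ω ω' h
    have hf : R.filter (· ∈ ω) = R.filter (· ∈ ω') := by
      ext i
      simp only [Finset.mem_filter, and_congr_right_iff]
      intro hi
      have := Set.ext_iff.1 h i
      simp only [Set.mem_inter_iff, Finset.mem_coe] at this
      exact ⟨fun h1 => (this.1 ⟨h1, hi⟩).1, fun h1 => (this.2 ⟨h1, hi⟩).1⟩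
    simp only [Set.mem_setOf_eq, hf]

/-- **Lower level bound.**  If `D` is `K`-determined and every `ω ∈ D` has `#(K∩ω) ≤ g`, then
`μD · φ_g ≤ μ(D ∩ {#(S∩ω) < s})`. [this work] -/
theorem mul_phi_le_real_inter_ball (p : ι → unitInterval) {K S : Finset ι} (hKS : K ⊆ S) {D : Set (Set ι)}
    (hDK : DeterminedBy D (↑K : Set ι)) (g s : ℕ) (hlev : ∀ ω ∈ D, (K.filter (· ∈ ω)).card ≤ g) :
    (prodBernoulli p).real D * (prodBernoulli p).real {ω : Set ι | ((S \ K).filter (· ∈ ω)).card + g < s} ≤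
      (prodBernoulli p).real (D ∩ {ω : Set ι | (S.filter (· ∈ ω)).card < s}) := by
  rw [← prodBernoulli_real_inter_of_determinedBy_disjoint p Finset.disjoint_sdiff hDK
    (real_inter_ball_le_mul_phi.determinedBy_shiftedBall (S \ K) g s) MeasurableSet.of_discrete MeasurableSet.of_discrete]
  refine measureReal_mono fun ω hω => ⟨hω.1, ?_⟩
  have h1 := hω.2
  simp only [Set.mem_setOf_eq] at h1 ⊢
  have h2 := card_filter_eq_add_sdiff hKS ω
  have h3 := hlev ω hω.1
  omega

omit [Fintype ι] in
/-- `φ_s = 0`: `{#(R∩ω) + s < s} = ∅`. [folklore] -/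
theorem real_shiftedBall_self (p : ι → unitInterval) (R : Finset ι) (s : ℕ) :
    (prodBernoulli p).real {ω : Set ι | (R.filter (· ∈ ω)).card + s < s} = 0 := by
  have h : {ω : Set ι | (R.filter (· ∈ ω)).card + s < s} = ∅ := by
    ext ω; simp only [Set.mem_setOf_eq, Set.mem_empty_iff_false, iff_false]; omega
  rw [h, measureReal_empty]

/-! ## §3 The costly region `G`, the hull `B♯` and the removal `B₂` -/

section reduct

variable {K : Finset ι} {g : ℕ} {A B : Set (Set ι)}

omit [Fintype ι] in
/-- The costly region `G = A ∩ {g ≤ #(K∩ω)}` is increasing. [this work] -/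
theorem isUpperSet_costly (hA : IsUpperSet A) (K : Finset ι) (g : ℕ) :
    IsUpperSet (A ∩ {ω : Set ι | g ≤ (K.filter (· ∈ ω)).card}) :=
  fun _ _ h12 h1 => ⟨hA h12 h1.1, (isUpperSet_threshold K g) h12 h1.2⟩

omit [Fintype ι] in
/-- `G` is `K`-determined. [this work] -/
theorem determinedBy_costly (hAK : DeterminedBy A (↑K : Set ι)) (g : ℕ) :
    DeterminedBy (A ∩ {ω : Set ι | g ≤ (K.filter (· ∈ ω)).card}) (↑K : Set ι) :=
  hAK.inter (determinedBy_threshold K g)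

omit [Fintype ι] in
/-- The removal `B₂ = ↑(B♯ ∖ G)` (written out) is increasing. [this work] -/
theorem isUpperSet_lift (Bs G : Set (Set ι)) :
    IsUpperSet {ω : Set ι | ∃ ω' : Set ι, ω' ⊆ ω ∧ ω' ∈ Bs ∧ ω' ∉ G} :=
  fun _ _ h12 ⟨ω', h1, h2, h3⟩ => ⟨ω', h1.trans h12, h2, h3⟩

omit [Fintype ι] in
/-- The removal is `K`-determined when `B♯` and `G` are. [this work] -/
theorem determinedBy_lift {Bs G : Set (Set ι)} (hBs : DeterminedBy Bs (↑K : Set ι)) (hG : DeterminedBy G (↑K : Set ι)) :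
    DeterminedBy {ω : Set ι | ∃ ω' : Set ι, ω' ⊆ ω ∧ ω' ∈ Bs ∧ ω' ∉ G} (↑K : Set ι) := by
  rw [determinedBy_iff] at hBs hG ⊢
  suffices key : ∀ ω₁ ω₂ : Set ι, ω₁ ∩ ↑K = ω₂ ∩ ↑K →
      ω₁ ∈ {ω : Set ι | ∃ ω' : Set ι, ω' ⊆ ω ∧ ω' ∈ Bs ∧ ω' ∉ G} →
      ω₂ ∈ {ω : Set ι | ∃ ω' : Set ι, ω' ⊆ ω ∧ ω' ∈ Bs ∧ ω' ∉ G} from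
    fun ω₁ ω₂ h12 => ⟨key ω₁ ω₂ h12, key ω₂ ω₁ h12.symm⟩
  rintro ω₁ ω₂ h12 ⟨ω', hsub, hBs', hG'⟩
  refine ⟨ω' ∩ ↑K, ?_, (hBs (ω' ∩ ↑K) ω' (by simp)).2 hBs', fun h => hG' ((hG (ω' ∩ ↑K) ω' (by simp)).1 h)⟩
  intro i hi
  have : i ∈ ω₂ ∩ ↑K := by rw [← h12]; exact ⟨hsub hi.1, hi.2⟩
  exact this.1

omit [Fintype ι] in
/-- The difference of two `K`-determined events is `K`-determined. [folklore] -/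
theorem determinedBy_sdiff' {X Y : Set (Set ι)} {F : Set ι} (hX : DeterminedBy X F) (hY : DeterminedBy Y F) :
    DeterminedBy (X \ Y) F := by
  rw [determinedBy_iff] at hX hY ⊢
  intro ω ω' h
  rw [Set.mem_sdiff, Set.mem_sdiff, hX ω ω' h, hY ω ω' h]

omit [Fintype ι] in
/-- `B₂ ⊆ B♯` (`B♯` increasing). [this work] -/
theorem lift_subset {Bs G : Set (Set ι)} (hBs : IsUpperSet Bs) :
    {ω : Set ι | ∃ ω' : Set ι, ω' ⊆ ω ∧ ω' ∈ Bs ∧ ω' ∉ G} ⊆ Bs :=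
  fun _ ⟨_, hsub, h, _⟩ => hBs hsub h

omit [Fintype ι] in
/-- What the removal removes lies in `G`: `B♯ ∖ B₂ ⊆ G`. [this work] -/
theorem sdiff_lift_subset (Bs G : Set (Set ι)) :
    Bs \ {ω : Set ι | ∃ ω' : Set ι, ω' ⊆ ω ∧ ω' ∈ Bs ∧ ω' ∉ G} ⊆ G := by
  intro ω hω
  by_contra hG
  exact hω.2 ⟨ω, subset_rfl, hω.1, hG⟩

omit [Fintype ι] in
/-- What the hull adds lies outside `G`: `B♯ ∖ B ⊆ Gᶜ`. [this work] -/
theorem hgen_sdiff_subset_compl (G B : Set (Set ι)) :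
    {ω : Set ι | ∀ ω' : Set ι, ω ⊆ ω' → ω' ∈ G → ω' ∈ B} \ B ⊆ Gᶜ :=
  fun ω hω hG => hω.2 (hω.1 ω subset_rfl hG)

/-- **The hull step does not increase `n`**: for the slot `H = Th_s(S)`, `K ⊆ S`, `A, B` increasing and `K`-determined, `G = A ∩ {g ≤ #(K∩ω)}`
with `g` a FREE level bound (`φ_{k}·μ(L∩Aᶜ) ≥ ℓ·μAᶜ` for all `k < g`): `n(A, B♯) ≤ n(A, B)`. [this work] -/
theorem osN_sharp_le (p : ι → unitInterval) {K S : Finset ι} (hKS : K ⊆ S) (s : ℕ) (hA : IsUpperSet A) (hB : IsUpperSet B)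
    (hAK : DeterminedBy A (↑K : Set ι)) (hBK : DeterminedBy B (↑K : Set ι)) (g : ℕ)
    (hfree : ∀ k < g, (prodBernoulli p).real {ω : Set ι | (S.filter (· ∈ ω)).card < s} * (1 - (prodBernoulli p).real A) ≤
      (prodBernoulli p).real {ω : Set ι | ((S \ K).filter (· ∈ ω)).card + k < s} *
        (prodBernoulli p).real (Aᶜ ∩ {ω : Set ι | (S.filter (· ∈ ω)).card < s})) :
    osN p {ω : Set ι | s ≤ (S.filter (· ∈ ω)).card} (ind A)
        (ind {ω : Set ι | ∀ ω' : Set ι, ω ⊆ ω' → ω' ∈ A ∩ {ω : Set ι | g ≤ (K.filter (· ∈ ω)).card} → ω' ∈ B}) ≤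
      osN p {ω : Set ι | s ≤ (S.filter (· ∈ ω)).card} (ind A) (ind B) := by
  set H : Set (Set ι) := {ω : Set ι | s ≤ (S.filter (· ∈ ω)).card} with hHdef
  set G : Set (Set ι) := A ∩ {ω : Set ι | g ≤ (K.filter (· ∈ ω)).card} with hGdef
  set Bs : Set (Set ι) := {ω : Set ι | ∀ ω' : Set ι, ω ⊆ ω' → ω' ∈ G → ω' ∈ B} with hBsdef
  have hHup : IsUpperSet H := isUpperSet_threshold S s
  -- `Bs = (B ∪ D₁) ∪ D₂`, `D₁ = (Bs ∖ B) ∖ A`, `D₂ = (Bs ∖ B) ∩ A`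
  set D₁ : Set (Set ι) := (Bs \ B) \ A with hD₁
  set D₂ : Set (Set ι) := (Bs \ B) ∩ A with hD₂
  have hBBs : B ⊆ Bs := subset_hgen G hB
  have hdec : Bs = (B ∪ D₁) ∪ D₂ := by
    ext ω
    simp only [hD₁, hD₂, Set.mem_union, Set.mem_sdiff, Set.mem_inter_iff]
    constructor
    · intro h
      by_cases hb : ω ∈ B
      · exact Or.inl (Or.inl hb)
      · by_cases ha : ω ∈ A
        · exact Or.inr ⟨⟨h, hb⟩, ha⟩
        · exact Or.inl (Or.inr ⟨⟨h, hb⟩, ha⟩)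
    · rintro ((hb | ⟨⟨h, _⟩, _⟩) | ⟨⟨h, _⟩, _⟩)
      · exact hBBs hb
      · exact h
      · exact h
  have hdisj1 : Disjoint B D₁ := Set.disjoint_left.2 fun ω hb hd => hd.1.2 hb
  have hdisj2 : Disjoint (B ∪ D₁) D₂ := Set.disjoint_left.2 fun ω h hd => by
    rcases h with hb | hd1
    · exact hd.1.2 hb
    · exact hd1.2 hd.2
  have hD₁A : Disjoint D₁ A := Set.disjoint_left.2 fun ω hd ha => hd.2 ha
  have hD₂A : D₂ ⊆ A := fun ω h => h.2
  rw [hdec]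
  refine le_trans ?_ (osN_ind_ind_union_right_le_of_disjoint p hHup hA hdisj1 hD₁A)
  rw [osN_ind_ind_union_right_of_subset p H A (B ∪ D₁) D₂ hdisj2 hD₂A]
  -- the variation on `D₂ ⊆ A ∩ {#(K∩ω) < g}` is `≤ 0`
  have hD₂K : DeterminedBy D₂ (↑K : Set ι) :=
    (determinedBy_sdiff' (determinedBy_hgen (determinedBy_costly hAK g) hBK) hBK).inter hAK
  have hlev : ∀ ω ∈ D₂, (K.filter (· ∈ ω)).card ≤ g - 1 := by
    intro ω hω
    have hnG : ω ∉ G := hgen_sdiff_subset_compl G B hω.1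
    have : ¬ g ≤ (K.filter (· ∈ ω)).card := fun h => hnG ⟨hω.2, h⟩
    omega
  rw [real_sub_real_inter_eq p H D₂, real_sub_real_inter_eq p H A]
  have hHc : Hᶜ = {ω : Set ι | (S.filter (· ∈ ω)).card < s} := by
    ext ω; simp only [hHdef, Set.mem_compl_iff, Set.mem_setOf_eq, not_le]
  rw [one_sub_real_threshold, hHc]
  set ℓ := (prodBernoulli p).real {ω : Set ι | (S.filter (· ∈ ω)).card < s} with hℓ
  have hsub : osN p H (ind A) (ind (B ∪ D₁)) +
      (ℓ * (prodBernoulli p).real D₂ * (1 - (prodBernoulli p).real A) -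
        (prodBernoulli p).real (D₂ ∩ {ω : Set ι | (S.filter (· ∈ ω)).card < s}) *
          (ℓ - (prodBernoulli p).real (A ∩ {ω : Set ι | (S.filter (· ∈ ω)).card < s}))) ≤
      osN p H (ind A) (ind (B ∪ D₁)) ↔
      ℓ * (prodBernoulli p).real D₂ * (1 - (prodBernoulli p).real A) ≤
        (prodBernoulli p).real (D₂ ∩ {ω : Set ι | (S.filter (· ∈ ω)).card < s}) *
          (ℓ - (prodBernoulli p).real (A ∩ {ω : Set ι | (S.filter (· ∈ ω)).card < s})) := by
    constructor <;> intro h <;> linarith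
  rw [hsub]
  -- `ℓ − μ(A∩L) = μ(Aᶜ∩L)`
  have hAc : ℓ - (prodBernoulli p).real (A ∩ {ω : Set ι | (S.filter (· ∈ ω)).card < s}) =
      (prodBernoulli p).real (Aᶜ ∩ {ω : Set ι | (S.filter (· ∈ ω)).card < s}) := by
    have h := measureReal_inter_add_sdiff (μ := prodBernoulli p) (s := {ω : Set ι | (S.filter (· ∈ ω)).card < s}) (t := A)
      MeasurableSet.of_discrete
    rw [Set.inter_comm] at h
    have h2 : {ω : Set ι | (S.filter (· ∈ ω)).card < s} \ A = Aᶜ ∩ {ω : Set ι | (S.filter (· ∈ ω)).card < s} := by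
      rw [Set.sdiff_eq, Set.inter_comm]
    rw [h2] at h
    linarith
  rw [hAc]
  rcases Nat.eq_zero_or_pos g with hg0 | hgpos
  · -- `g = 0`: `D₂ = ∅`
    have hD₂e : (prodBernoulli p).real D₂ = 0 := by
      have : D₂ = ∅ := Set.eq_empty_of_forall_notMem fun ω hω => by
        have hnG : ω ∉ G := hgen_sdiff_subset_compl G B hω.1
        exact hnG ⟨hω.2, by simp only [Set.mem_setOf_eq]; omega⟩
      rw [this, measureReal_empty]
    rw [hD₂e, mul_zero, zero_mul]
    exact mul_nonneg measureReal_nonneg measureReal_nonneg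
  · have h1 := mul_phi_le_real_inter_ball p hKS hD₂K (g - 1) s hlev
    have h2 := hfree (g - 1) (by omega)
    have h3 : 0 ≤ (prodBernoulli p).real (Aᶜ ∩ {ω : Set ι | (S.filter (· ∈ ω)).card < s}) := measureReal_nonneg
    have h4 : 0 ≤ (prodBernoulli p).real D₂ := measureReal_nonneg
    calc ℓ * (prodBernoulli p).real D₂ * (1 - (prodBernoulli p).real A)
        = (prodBernoulli p).real D₂ * (ℓ * (1 - (prodBernoulli p).real A)) := by ring
      _ ≤ (prodBernoulli p).real D₂ * ((prodBernoulli p).real {ω : Set ι | ((S \ K).filter (· ∈ ω)).card + (g - 1) < s} *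
            (prodBernoulli p).real (Aᶜ ∩ {ω : Set ι | (S.filter (· ∈ ω)).card < s})) :=
          mul_le_mul_of_nonneg_left h2 h4
      _ = ((prodBernoulli p).real D₂ * (prodBernoulli p).real {ω : Set ι | ((S \ K).filter (· ∈ ω)).card + (g - 1) < s}) *
            (prodBernoulli p).real (Aᶜ ∩ {ω : Set ι | (S.filter (· ∈ ω)).card < s}) := by ring
      _ ≤ (prodBernoulli p).real (D₂ ∩ {ω : Set ι | (S.filter (· ∈ ω)).card < s}) *
            (prodBernoulli p).real (Aᶜ ∩ {ω : Set ι | (S.filter (· ∈ ω)).card < s}) :=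
          mul_le_mul_of_nonneg_right h1 h3

/-- **The removal step does not increase `n`**: with `g` a COSTLY level bound (`φ_g·μ(L∩Aᶜ) ≤ ℓ·μAᶜ`), for any increasing `K`-determined
`Bs` (e.g. the hull `B♯`): `n(A, ↑(Bs ∖ G)) ≤ n(A, Bs)`. [this work] -/
theorem osN_lift_le (p : ι → unitInterval) {K S : Finset ι} (hKS : K ⊆ S) (s : ℕ) {Bs : Set (Set ι)}
    (hBs : IsUpperSet Bs) (hAK : DeterminedBy A (↑K : Set ι)) (hBsK : DeterminedBy Bs (↑K : Set ι)) (g : ℕ)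
    (hcost : (prodBernoulli p).real {ω : Set ι | ((S \ K).filter (· ∈ ω)).card + g < s} *
        (prodBernoulli p).real (Aᶜ ∩ {ω : Set ι | (S.filter (· ∈ ω)).card < s}) ≤
      (prodBernoulli p).real {ω : Set ι | (S.filter (· ∈ ω)).card < s} * (1 - (prodBernoulli p).real A)) :
    osN p {ω : Set ι | s ≤ (S.filter (· ∈ ω)).card} (ind A)
        (ind {ω : Set ι | ∃ ω' : Set ι, ω' ⊆ ω ∧ ω' ∈ Bs ∧ ω' ∉ A ∩ {ω : Set ι | g ≤ (K.filter (· ∈ ω)).card}}) ≤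
      osN p {ω : Set ι | s ≤ (S.filter (· ∈ ω)).card} (ind A) (ind Bs) := by
  set H : Set (Set ι) := {ω : Set ι | s ≤ (S.filter (· ∈ ω)).card} with hHdef
  set G : Set (Set ι) := A ∩ {ω : Set ι | g ≤ (K.filter (· ∈ ω)).card} with hGdef
  set B₂ : Set (Set ι) := {ω : Set ι | ∃ ω' : Set ι, ω' ⊆ ω ∧ ω' ∈ Bs ∧ ω' ∉ G} with hB₂def
  set D : Set (Set ι) := Bs \ B₂ with hDdef
  have hB₂Bs : B₂ ⊆ Bs := lift_subset hBs
  have hdec : Bs = B₂ ∪ D := by rw [hDdef, Set.union_sdiff_cancel hB₂Bs]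
  have hdisj : Disjoint B₂ D := Set.disjoint_sdiff_right
  have hDG : D ⊆ G := sdiff_lift_subset Bs G
  have hDA : D ⊆ A := fun ω h => (hDG h).1
  rw [hdec, osN_ind_ind_union_right_of_subset p H A B₂ D hdisj hDA]
  have hDK : DeterminedBy D (↑K : Set ι) :=
    determinedBy_sdiff' hBsK (determinedBy_lift hBsK (determinedBy_costly hAK g))
  have hlev : ∀ ω ∈ D, g ≤ (K.filter (· ∈ ω)).card := fun ω hω => (hDG hω).2
  rw [real_sub_real_inter_eq p H D, real_sub_real_inter_eq p H A]
  have hHc : Hᶜ = {ω : Set ι | (S.filter (· ∈ ω)).card < s} := by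
    ext ω; simp only [hHdef, Set.mem_compl_iff, Set.mem_setOf_eq, not_le]
  rw [one_sub_real_threshold, hHc]
  set ℓ := (prodBernoulli p).real {ω : Set ι | (S.filter (· ∈ ω)).card < s} with hℓ
  have hAc : ℓ - (prodBernoulli p).real (A ∩ {ω : Set ι | (S.filter (· ∈ ω)).card < s}) =
      (prodBernoulli p).real (Aᶜ ∩ {ω : Set ι | (S.filter (· ∈ ω)).card < s}) := by
    have h := measureReal_inter_add_sdiff (μ := prodBernoulli p) (s := {ω : Set ι | (S.filter (· ∈ ω)).card < s}) (t := A)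
      MeasurableSet.of_discrete
    rw [Set.inter_comm] at h
    have h2 : {ω : Set ι | (S.filter (· ∈ ω)).card < s} \ A = Aᶜ ∩ {ω : Set ι | (S.filter (· ∈ ω)).card < s} := by
      rw [Set.sdiff_eq, Set.inter_comm]
    rw [h2] at h
    linarith
  rw [hAc]
  have h1 := real_inter_ball_le_mul_phi p hKS hDK g s hlev
  have h3 : 0 ≤ (prodBernoulli p).real (Aᶜ ∩ {ω : Set ι | (S.filter (· ∈ ω)).card < s}) := measureReal_nonneg
  have h4 : 0 ≤ (prodBernoulli p).real D := measureReal_nonneg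
  have key : (prodBernoulli p).real (D ∩ {ω : Set ι | (S.filter (· ∈ ω)).card < s}) *
        (prodBernoulli p).real (Aᶜ ∩ {ω : Set ι | (S.filter (· ∈ ω)).card < s}) ≤
      ℓ * (prodBernoulli p).real D * (1 - (prodBernoulli p).real A) :=
    calc (prodBernoulli p).real (D ∩ {ω : Set ι | (S.filter (· ∈ ω)).card < s}) *
          (prodBernoulli p).real (Aᶜ ∩ {ω : Set ι | (S.filter (· ∈ ω)).card < s})
        ≤ ((prodBernoulli p).real D * (prodBernoulli p).real {ω : Set ι | ((S \ K).filter (· ∈ ω)).card + g < s}) *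
            (prodBernoulli p).real (Aᶜ ∩ {ω : Set ι | (S.filter (· ∈ ω)).card < s}) := mul_le_mul_of_nonneg_right h1 h3
      _ = (prodBernoulli p).real D * ((prodBernoulli p).real {ω : Set ι | ((S \ K).filter (· ∈ ω)).card + g < s} *
            (prodBernoulli p).real (Aᶜ ∩ {ω : Set ι | (S.filter (· ∈ ω)).card < s})) := by ring
      _ ≤ (prodBernoulli p).real D * (ℓ * (1 - (prodBernoulli p).real A)) := mul_le_mul_of_nonneg_left hcost h4
      _ = ℓ * (prodBernoulli p).real D * (1 - (prodBernoulli p).real A) := by ring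
  linarith

end reduct

end SahiOneStep

end Summit.CriticalPhenomena.PercolationContinuityZ3.Theorems
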